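import Literature.NumberTheory.Automorphic.IsAutomorphicAE
import Literature.NumberTheory.Automorphic.AdicCompletionLocalField
import Literature.NumberTheory.GaloisRepresentations.LabelledHodgeTateWeights
import Literature.NumberTheory.GaloisRepresentations.SymplecticMultiplier
import Literature.NumberTheory.GaloisRepresentations.AbsolutelyIrreducibleReduction
import Literature.NumberTheory.GaloisRepresentations.ModPGaloisRep
import Literature.NumberTheory.PAdicHodge.FontaineDpst
import HarnessLib

/-!
# Automorphy lifting in the potentially diagonalizable case for `GL₄` over `ℚ`, symplectic
# Fontaine–Laffaille form (Barnet-Lamb–Gee–Geraghty–Taylor 2014, Thm. 4.2.1 with the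
# "Fontaine–Laffaille" remark following it, over `ℚ` by the base-change argument of Cor. 4.5.2)

Topic `Literature/NumberTheory/Automorphic`; sibling of `PDAutomorphyLiftingGL2TotallyReal`
(`BLGGT2014_thm421_GL2_totallyReal`, the same printed theorem for `n = 2` over totally real
fields), whose binder style is followed symbol for symbol where the two overlap.  Cite item of
the crux `stmt-Langlands-17765` (`Summit.Langlands.Langlands.Theses.AbelianSurfaceSerre.SerreGSp4Surjective`),
line `singer-type-evaporation`, stub `stub_automorphyLifting` ("Fontaine–Laffaille automorphy
lifting over `ℚ`, `n = 4`, `ℓ ≥ 11`").  One NAMED FACT (D-0014), `BLGGT2014_thm421_rat_GL4`,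
and its proved projection onto the tree's `IsAutomorphicAE`.

## The printed theorems (quoted from the held texts, read 2026-08-17)

* T. Barnet-Lamb, T. Gee, D. Geraghty, R. Taylor, *Potential automorphy and change of weight*,
  Ann. of Math. 179 (2014) 501–609 [BarnetlambEtAl2014] (held: arXiv:1010.2561, p. 26),
  **Theorem 4.2.1**: "Let `F` be an imaginary CM field with maximal totally real subfield `F⁺`
  and let `c` denote the non-trivial element of `Gal(F/F⁺)`. Suppose that `n ∈ ℤ_{≥1}` and that
  `l` is an odd prime. Let `r : G_F → GL_n(ℚ̄_l)` be a continuous irreducible representation and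
  let `r̄` denote the semi-simplification of the reduction of `r`. Let `d` denote the maximal
  dimension of an irreducible sub-representation of the restriction of `r̄` to the closed
  subgroup of `G_F` generated by all Sylow pro-`l`-subgroups. Also let `μ : G_{F⁺} → ℚ̄_l^×` be a
  continuous character. Suppose that `r` and `μ` enjoy the following properties:
  • `r^c ≅ r^∨ μ`. • `r` ramifies at only finitely many primes. • `r|_{G_{F_v}}` is potentially
  diagonalizable (and so in particular potentially crystalline) for all `v ∣ l` and for each
  embedding `τ : F ↪ ℚ̄_l` it has `n` distinct `τ`-Hodge–Tate numbers. • The restriction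
  `r̄|_{G_{F(ζ_l)}}` is irreducible, `l ≥ 2(d+1)`, and `ζ_l ∉ F`. • There is a RAECSDC
  automorphic representation `(π, χ)` of `GL_n(𝔸_F)` such that
  `(r̄, μ̄) ≅ (r̄_{l,ı}(π), r̄_{l,ı}(χ) ε̄_l^{1−n})`. Suppose further that • either `π` is
  `ı`-ordinary, • or `π` has level potentially prime to `l` and `r_{l,ı}(π)|_{G_{F_v}}` is
  potentially diagonalizable for all `v ∣ l`. Then `(r, μ)` is automorphic of level potentially
  prime to `l`."  Immediately after the statement (p. 26): "We remark that condition 3 of the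
  theorem will be satisfied if, in particular, `l` is unramified in `F` and `r` is crystalline at
  all primes above `l`, and `HT_τ(r)` is contained in an interval of the form `[a_τ, a_τ + l − 2]`
  for all `τ` (the 'Fontaine–Laffaille' case)" — this is Lemma 1.4.3 (2) ibid. (p. 15): "If
  `K/ℚ_l` is unramified, if `ρ` is crystalline and if for each `τ : K ↪ ℚ̄_l` the Hodge–Tate
  numbers `HT_τ(ρ) ⊂ [a_τ, a_τ + l − 2]` for some integer `a_τ`, then `ρ` is potentially
  diagonalizable."
* §2.1 ibid. (pp. 17–18), for `F` totally real: "`(r, μ)` is essentially conjugate self-dual if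
  and only if `r` factors through `GSp_n(ℚ̄_l)` (if `μ(c_v) = −ε_v`) or `GO_n(ℚ̄_l)` (if
  `μ(c_v) = ε_v`) with multiplier `μ`"; "totally odd, essentially conjugate self-dual if they are
  essentially conjugate self-dual and `ε_v = 1` for all `v ∣ ∞`"; a RAESDC representation of
  `GL_n(𝔸_F)` is a pair `(π, χ)`, `π` cuspidal with `π_∞` of the same infinitesimal character as an
  algebraic representation, `χ_v(−1)` independent of `v ∣ ∞`, `π ≅ π^∨ ⊗ (χ ∘ det)`; "`(π, χ)` has
  level prime to `l` … if for all `v ∣ l` the representation `π_v` is unramified"; to `(π, χ)`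
  is attached `r_{l,ı}(π)` with `ı WD(r_{l,ı}(π)|_{G_{F_v}})^{F-ss} ≅ rec(π_v ⊗ |det|_v^{(1−n)/2})`
  (`v ∤ l`), "de Rham (crystalline if `π_v` is unramified for all `v ∣ l`)", and
  "`(r_{l,ı}(π), ε_l^{1−n} r_{l,ı}(χ))` is totally odd, essentially conjugate self-dual"; "`(r, μ)` …
  automorphic if there is a RAESDC or RAECSDC representation `(π, χ)` such that
  `(r, μ) ≅ (r_{l,ı}(π), r_{l,ı}(χ) ε_l^{1−n})`".
* The passage from imaginary CM `F` to a totally real base (here `ℚ`) is the one printed in the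
  proof of **Corollary 4.5.2** ibid. (p. 30): "Choose `F/F⁺` a totally imaginary quadratic
  extension in which all the places lying over `l` split completely, and which is linearly
  disjoint from `(F̄⁺)^{ker ad r̄}(ζ_l)` over `F⁺`. … By Lemma 1.5 of [blght],
  `(r|_{G_{F'^{,+}}}, μ|_{G_{F'^{,+}}})` is also automorphic", together with the base-change
  remark of §2.2 (p. 19) "by making a base change to a finite, soluble, Galois, CM extension
  `F'/F` which is linearly disjoint from `F̄^{ker r̄_{l,ı}(π)}(ζ_l)` over `F`", and with
  T. Barnet-Lamb, D. Geraghty, M. Harris, R. Taylor, *A family of Calabi–Yau varieties and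
  potential automorphy II*, Publ. RIMS 47 (2011) 29–98 [BarnetlambEtAl2011] (held:
  doi:10.2977/prims/31, p. 42), **Lemma 1.5**: "Suppose that `F` is an imaginary CM field; that
  `χ : Gal(F̄/F⁺) → ℚ̄_l^×` is a continuous character whose value at complex conjugations,
  `χ(c_v)`, is independent of the infinite place `v`; and that `r : Gal(F̄/F⁺) → GL_n(ℚ̄_l)` is a
  continuous semisimple representation with `r^∨ ≅ r ⊗ χ`. Suppose also that `r|_{Gal(F̄/F)}` is
  irreducible and automorphic of weight `a`. Then: … 2. `r` is automorphic over `F⁺` of weight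
  `a_{F⁺}`."  (For `n = 2` the same deduction is Dieulefait–Pacetti 2015, Thm. 8.11, used by the
  sibling file.)

So, over `ℚ`, for `n = 4` and the multiplier `μ = ε_l⁻¹`, the printed hypotheses are: `l ≥ 11`
(`l` odd, `l ≥ 2(d+1)` with `d ≤ 4`; `ζ_l ∉ ℚ`); `r : G_ℚ → GL₄(ℚ̄_l)` continuous, irreducible,
unramified at almost all primes, symplectic with multiplier `ε_l⁻¹` (= "`(r, ε_l⁻¹)` totally odd
essentially self-dual": `ε_l⁻¹(c) = −1`, so `ε_∞ = 1`); `r|_{G_{ℚ_l}}` crystalline with four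
distinct Hodge–Tate numbers lying in an interval of length `l − 2` (the Fontaine–Laffaille case
of potential diagonalizability: `l` is unramified in `ℚ`); `r̄|_{G_{ℚ(ζ_l)}}` irreducible; and
`r̄ ≅ r̄_{l,ı}(π)`, `ε̄_l⁻¹ = r̄_{l,ı}(χ) ε̄_l^{−3}` for a RAESDC `(π, χ)` of `GL₄(𝔸_ℚ)` with `π_l`
unramified and `r_{l,ı}(π)|_{G_{ℚ_l}}` potentially diagonalizable (e.g. Fontaine–Laffaille).
Conclusion: `r ≅ r_{l,ı}(π')` for a RAESDC `(π', χ')` of `GL₄(𝔸_ℚ)`.  (Proof in print: choose an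
imaginary quadratic `F/ℚ` split at `l` and linearly disjoint from `ℚ̄^{ker r̄}(ζ_l)`; the base
change of `(π, χ)` to `F` (Arthur–Clozel) is RAECSDC of level prime to `l`, with
`r_{l,ı}(π_F) = r_{l,ı}(π)|_{G_F}`, the same local representations at the two places over `l`;
`(r|_{G_F}, ε_l⁻¹)` satisfies every hypothesis of Thm. 4.2.1; conclude over `F` and descend to `ℚ`
by [BarnetlambEtAl2011] Lemma 1.5, `r` being irreducible.)

## Rendering in the tree's vocabulary (read before reviewing)

Binders follow the accepted sibling `BLGGT2014_thm421_GL2_totallyReal`: `ρ : Γ_ℚ → GL₄(ℚ̄_ℓ)`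
continuous (`FramedGaloisRep`), irreducible (`toGaloisRep.IsIrreducible`), unramified at almost
all places; automorphic representations are `CuspidalAutomorphicRepData 4 ℚ hcpt` (the named fact
`hcpt : isCompact_glFiniteIntegralLevel 4 ℚ` only TYPES `π`, `∀ hcpt`); "attached via `ı`" is
`SatakeFrobCompatibleAE ι π.1 ρ` in Buzzard–Gee's `L`-normalisation, for `π` `L`-algebraic with a
regular infinity type — i.e. `π ⊗ |det|^{3/2}` is regular algebraic (Clozel) and
`ρ ≅ r_{l,ı}(π ⊗ |det|^{3/2})` in the normalisation `rec(π_v ⊗ |det|_v^{(1−n)/2})` of [BLGGT] §2.1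
(`arithFrobPolyOfSatake ι q 1 (q^{3/2} α) = arithFrobPolyOfSatake ι q 4 α`); the conclusion
"`(r, μ)` is automorphic" is rendered, as in the sibling, by `SatakeFrobCompatibleAE ι π.1 ρ` for a
cuspidal `L`-algebraic `π` with a regular infinity type (the character `χ'` and "of level
potentially prime to `l`" are dropped: weaker statement).  The hypotheses specific to this file:

* **`(r, ε_ℓ⁻¹)` totally odd essentially self-dual** — `ρ.IsSymplecticWithMultiplierFun ν` for the
  explicit multiplier function `ν(g) = ε_ℓ(g)⁻¹ ∈ ℚ̄_ℓ` (accepted `SymplecticMultiplier`,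
  `GaloisRep.cyclotomicCharacter`; `∃ J, Jᵀ = −J, det J ≠ 0, ρ(g)ᵀ J ρ(g) = ε_ℓ(g)⁻¹ J`), which is
  [BLGGT] §2.1's "`r` factors through `GSp₄` with multiplier `μ = ε_l⁻¹`"; total oddness
  `μ(c) = −ε_∞ = −1` holds because `ε_l(c) = −1`.
  -- TODO(general form): arbitrary continuous multiplier `μ` with `μ(c) = −1`, and the `GO_n` case.
* **Fontaine–Laffaille at `ℓ`** (the printed remark after Thm. 4.2.1 = Lemma 1.4.3 (2)): for the
  place `v ∣ ℓ` of `ℚ`, `ρ|_{Γ_{ℚ_v}}` is CRYSTALLINE for Fontaine's pinned datum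
  `fontainePstAdicCompletion v ℓ hv` (`IsCrystallineFramed`) and, for every `ℚ_ℓ`-algebra label
  `τ : ℚ_v → ℚ̄_ℓ` (the idiom of the sibling), the multiset
  `M = ρ.labelledHodgeTateWeightsAt v D.algebra D.𝔅 τ` is multiplicity-free of cardinality `4`
  ("`n` distinct `τ`-Hodge–Tate numbers") and contained in `[a, a + ℓ − 2]` for some `a ∈ ℤ`
  (convention `HT(ε_ℓ) = {−1}` on both sides).  `ℓ` is unramified in `ℚ`.
  -- TODO(general form): potentially diagonalizable `ρ|_{Γ_{ℚ_ℓ}}` (`IsPotentiallyDiagonalizable`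
  -- over `PstCrystallineExtensionData`, as in the sibling) instead of Fontaine–Laffaille.
* **`r̄|_{G_{ℚ(ζ_ℓ)}}` irreducible.**  BLGGT's `r̄` (the semisimplified reduction, over the residue
  field `𝔽 = 𝒪_{ℚ̄_ℓ}/𝔪`, an algebraic closure of `𝔽_ℓ`) is rendered by a continuous
  `ρbar : Γ_ℚ → GL₄(k)`, `k` a finite field of characteristic `ℓ`, and a ring homomorphism
  `red : 𝒪_{ℚ̄_ℓ} → k̄` (`𝒪_{ℚ̄_ℓ} = Valued.v.valuationSubring`, Mathlib) along which the (integral)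
  characteristic polynomials of `ρ` reduce to those of `ρbar ⊗_k k̄`.  Any such `red` kills `ℓ`,
  hence (the valuation having rank one) has kernel `𝔪` and induces an ISOMORPHISM `𝔽 ≅ k̄` (an
  embedding of the algebraically closed `𝔽` into `k̄`, which is algebraic over `𝔽_ℓ`), so the
  clause says precisely `r̄^{ss} ⊗_{𝔽, red} k̄ ≅ (ρbar ⊗_k k̄)^{ss}` (Brauer–Nesbitt); irreducibility
  of `r̄|_{G_{ℚ(ζ_ℓ)}}` is then `Representation.IsIrreducible` (Mathlib) of `ρbar ⊗_k k̄` restricted to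
  `ker ε̄_ℓ = Γ_{ℚ(ζ_ℓ)}` (accepted `modPCyclotomicCharacterZMod`), absolute irreducibility being
  insensitive to the isomorphism `𝔽 ≅ k̄`.  This is verbatim the idiom (`ReducesTo`,
  `IrredOnCycKernel`) of the requesting line.  `11 ≤ ℓ` is "`l` odd, `l ≥ 2(d+1)`" for `d ≤ n = 4`.
* **Residual automorphy from a source of level prime to `ℓ`, Fontaine–Laffaille at `ℓ`**
  (BLGGT's second alternative, in the Fontaine–Laffaille case of potential diagonalizability):
  a witness `(π₀, ρ₀)` with `π₀` cuspidal, `L`-algebraic with a regular infinity type and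
  UNRAMIFIED at `v ∣ ℓ` ("level prime to `l`", the special case of "potentially prime to `l`" the
  tree can phrase), `ρ₀` attached to `π₀` via `ι` at almost all places, `ρ₀|_{Γ_{ℚ_v}}` crystalline
  with Hodge–Tate weights in an interval `[a, b]` of length `≤ ℓ − 2` (accepted
  `IsDeRhamWithWeightsIn`; Fontaine–Laffaille ⇒ potentially diagonalizable, Lemma 1.4.3 (2)),
  `ρ₀` SYMPLECTIC with the same multiplier `ε_ℓ⁻¹`, and `ρ ≡ ρ₀` residually — the accepted
  `FramedRep.IsResiduallyCongruent ρ ρ₀` (coefficientwise congruence of characteristic polynomials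
  modulo `𝔪_{ℚ̄_ℓ}`, i.e. `r̄^{ss} ≅ r̄₀^{ss}` by Brauer–Nesbitt).  Why this is the printed residual
  hypothesis: `r̄₀^{ss} ≅ r̄^{ss}` is absolutely irreducible, so `ρ₀` is irreducible and hence
  `ρ₀ ≅ r_{l,ı}(Π₀)` for the regular algebraic `Π₀ = π₀ ⊗ |det|^{3/2}` (Chebotarev, Brauer–Nesbitt;
  `r_{l,ı}(Π₀)` exists by [BLGGT] Thm. 2.1.1 / Harris–Lan–Taylor–Thorne and is semisimple); from
  `ρ₀ ≅ ρ₀^∨ ⊗ ε_l⁻¹` one gets `r_{l,ı}(Π₀^∨ ⊗ |det|²) ≅ r_{l,ı}(Π₀)` (`r_{l,ı}(Π^∨) = r_{l,ı}(Π)^∨ ε_l^{1−n}`,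
  `r_{l,ı}(|·|) = ε_l`), so `Π₀ ≅ Π₀^∨ ⊗ |det|²` by strong multiplicity one (Jacquet–Shalika 1981,
  Thm. 4.8): `(Π₀, |·|²)` is RAESDC (one infinite place) with
  `r_{l,ı}(χ) ε_l^{1−n} = ε_l² ε_l^{−3} = ε_l⁻¹ = μ`, and `(r̄, μ̄) ≅ (r̄_{l,ı}(Π₀), r̄_{l,ı}(χ) ε̄_l^{−3})`;
  `r_{l,ı}(Π₀)|_{G_{ℚ_l}} ≅ ρ₀|_{G_{ℚ_l}}` is Fontaine–Laffaille, hence potentially diagonalizable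
  (Lemma 1.4.3 (2); invariance under conjugation, Lemma 1.4.1).
  -- TODO(general form): the automorphic-side datum "(π₀, χ₀) RAESDC" (tree
  -- `IsGalConjEssSelfDual π₀ (AlgEquiv.refl) χ₀`) instead of "ρ₀ symplectic"; `π₀` of level
  -- potentially prime to `ℓ`; the `ı`-ordinary alternative; the conclusion's level clause.

## What is NOT here (reported on the item)

The requesting stub quantifies the residual representation `ρ'` and lets the source reduce to
`ρ'` along its OWN residue map (`ResiduallyAutomorphic ℓ ρ'` hides a second `red₁ : 𝒪_{ℚ̄_ℓ} → k̄`);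
two such maps differ by an element of `Gal(k̄/𝔽_ℓ)`, so those hypotheses give only
`r̄ ≅ {}^φ r̄_{l,ı}(π)` for a Frobenius power `φ`, which becomes the printed hypothesis after
replacing `ı` by `ı ∘ σ̃⁻¹` for a lift `σ̃ ∈ G_{ℚ_ℓ}` of `φ`.  That re-choice of `ı` is not part of
the printed theorem and is not vendored here: this fact asks for the congruence `ρ ≡ ρ₀` in
`𝒪_{ℚ̄_ℓ}` itself (`IsResiduallyCongruent`), as the sibling does with traces.

## References

* T. Barnet-Lamb, T. Gee, D. Geraghty, R. Taylor, Ann. of Math. 179 (2014) 501–609, Thm. 4.2.1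
  and the remark following it, Lemma 1.4.3 (2), Lemma 1.4.1, §2.1, Thm. 2.1.1, proof of Cor. 4.5.2
  (arXiv:1010.2561 pp. 26, 15, 14, 17–18, 30). [BarnetlambEtAl2014]
* T. Barnet-Lamb, D. Geraghty, M. Harris, R. Taylor, Publ. RIMS 47 (2011) 29–98, Lemma 1.5
  (and Lemma 1.4: soluble base change). [BarnetlambEtAl2011]
* R. Guralnick, F. Herzig, R. Taylor, J. Thorne, appendix "Adequate subgroups" to J. Thorne,
  J. Inst. Math. Jussieu 11 (2012), Thm. 9 (`l ≥ 2(d+1)` and irreducible ⇒ adequate; this is how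
  the hypothesis "`r̄|_{G_{F(ζ_l)}}` irreducible, `l ≥ 2(d+1)`" of Thm. 4.2.1 is used). [Thorne2012]
* H. Jacquet, J. Shalika, Amer. J. Math. 103 (1981), Thm. 4.8 (strong multiplicity one).
  [JacquetShalika1981]
* L. Dieulefait, A. Pacetti, LMS Lecture Note Ser. 420 (2015), Thm. 8.11 (the `n = 2` analogue of
  the passage to totally real fields). [DieulefaitPacetti2015]
-/

noncomputable section

open scoped MatrixGroups Matrix NumberField
open NumberField IsDedekindDomain Field Filter

namespace Literature.NumberTheory.Automorphic

open Literature.NumberTheory.GaloisRepresentations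

/-- **Barnet-Lamb–Gee–Geraghty–Taylor 2014, Theorem 4.2.1, for `GL₄` over `ℚ`, symplectic with
multiplier `ε_ℓ⁻¹`, Fontaine–Laffaille case at `ℓ ≥ 11`** (automorphy lifting in the potentially
diagonalizable case; see the module docstring for the printed statements — Thm. 4.2.1, the
"Fontaine–Laffaille" remark following it, §2.1, the proof of Cor. 4.5.2 and [BLGHT] Lemma 1.5 for
the passage from an imaginary quadratic field to `ℚ` — and for the rendering, hypothesis by
hypothesis).
Let `ℓ ≥ 11` be prime and `ρ : Γ_ℚ → GL₄(ℚ̄_ℓ)` continuous, irreducible, unramified at all but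
finitely many places, SYMPLECTIC WITH MULTIPLIER `ε_ℓ⁻¹` (so `(ρ, ε_ℓ⁻¹)` is totally odd
essentially self-dual), CRYSTALLINE at the place `v ∣ ℓ` for Fontaine's pinned datum with four
distinct `τ`-labelled Hodge–Tate weights contained in an interval of length `ℓ − 2` for every
`ℚ_ℓ`-label `τ` (Fontaine–Laffaille, hence potentially diagonalizable).  Suppose the residual
representation — any continuous `ρbar : Γ_ℚ → GL₄(k)`, `k` finite of characteristic `ℓ`, to whose
base change to `k̄` the integral characteristic polynomials of `ρ` reduce along a ring homomorphism
`red : 𝒪_{ℚ̄_ℓ} → k̄` — is irreducible on `Γ_{ℚ(ζ_ℓ)} = ker ε̄_ℓ`, and suppose `ρ` is RESIDUALLY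
AUTOMORPHIC FROM A FONTAINE–LAFFAILLE SOURCE OF LEVEL PRIME TO `ℓ`: `ρ ≡ ρ₀` modulo `𝔪_{ℚ̄_ℓ}`
(`IsResiduallyCongruent`: congruent characteristic polynomials, i.e. `ρ̄^{ss} ≅ ρ̄₀^{ss}`) for some
`ρ₀`, symplectic with multiplier `ε_ℓ⁻¹`, crystalline at `v ∣ ℓ` with Hodge–Tate weights in an
interval of length `≤ ℓ − 2`, attached at almost all places through `ι : ℚ̄_ℓ ≃ ℂ` to a cuspidal
automorphic representation `π₀` of `GL₄(𝔸_ℚ)` that is `L`-algebraic with a regular infinity type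
and unramified at `v ∣ ℓ`.  Then `ρ` is automorphic: some cuspidal `π` of `GL₄(𝔸_ℚ)`,
`L`-algebraic with a regular infinity type, is attached to `ρ` at almost all places
(`SatakeFrobCompatibleAE ι π.1 ρ`, Buzzard–Gee's `L`-normalisation).  Named fact (D-0014),
`∀ hcpt`.  Printed for imaginary CM fields; over `ℚ` deduced in print by base change to an
imaginary quadratic field split at `ℓ` and linearly disjoint from `ℚ̄^{ker ρ̄}(ζ_ℓ)` and descent
([BLGGT] proof of Cor. 4.5.2; [BLGHT] Lemma 1.5).
-- TODO(general form): totally real `F` and general `n` (`GSp_n` / `GO_n`, general multiplier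
-- `μ`); potentially diagonalizable instead of Fontaine–Laffaille; `π₀` of level potentially
-- prime to `ℓ`, or `ı`-ordinary; conclusion as a RAESDC pair of level potentially prime to `ℓ`.
[cite: BarnetlambEtAl2014, Thm. 4.2.1 with the remark following it (Lemma 1.4.3 (2)), §2.1, and the proof of Cor. 4.5.2] [cite: BarnetlambEtAl2011, Lemma 1.5] -/
def BLGGT2014_thm421_rat_GL4 : Prop :=
  ∀ (ℓ : ℕ) [Fact ℓ.Prime], 11 ≤ ℓ →
    ∀ (hcpt : isCompact_glFiniteIntegralLevel 4 ℚ) (ι : PadicAlgCl ℓ ≃+* ℂ)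
      (ρ : FramedGaloisRep ℚ (PadicAlgCl ℓ) 4),
      -- `r` is irreducible
      ρ.toGaloisRep.IsIrreducible →
      -- `r` ramifies at only finitely many primes
      (∀ᶠ v : HeightOneSpectrum (𝓞 ℚ) in cofinite, ρ.IsUnramifiedAt v) →
      -- `(r, ε_ℓ⁻¹)` totally odd essentially self-dual: symplectic with multiplier `ε_ℓ⁻¹`
      ρ.IsSymplecticWithMultiplierFun (fun g => algebraMap ℚ_[ℓ] (PadicAlgCl ℓ)
        ((((GaloisRep.cyclotomicCharacter ℚ ℓ g)⁻¹ : ℤ_[ℓ]ˣ) : ℤ_[ℓ]) : ℚ_[ℓ])) →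
      -- Fontaine–Laffaille at `v ∣ ℓ`: crystalline, four distinct labelled Hodge–Tate weights in
      -- an interval of length `ℓ - 2`, for every `ℚ_ℓ`-label `τ`
      (∀ (v : HeightOneSpectrum (𝓞 ℚ)) (hv : ((ℓ : ℕ) : 𝓞 ℚ) ∈ v.asIdeal),
        let D := PAdicHodge.fontainePstAdicCompletion v ℓ hv
        D.IsCrystallineFramed (ρ.toLocal v) ∧
        (letI := D.algebra
         ∀ τ : v.adicCompletion ℚ →ₐ[ℚ_[ℓ]] PadicAlgCl ℓ,
          let M := ρ.labelledHodgeTateWeightsAt v D.algebra D.𝔅 τ.toRingHom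
          M.Nodup ∧ Multiset.card M = 4 ∧ ∃ a : ℤ, ∀ h ∈ M, a ≤ h ∧ h ≤ a + ((ℓ : ℤ) - 2))) →
      -- the residual representation `r̄`, read in `k̄` for a finite field `k` of characteristic `ℓ`
      ∀ (k : Type) [Field k] [Fintype k] [CharP k ℓ] [TopologicalSpace k] [DiscreteTopology k]
        (ρbar : FramedGaloisRep ℚ k 4)
        (red : (Valued.v : Valuation (PadicAlgCl ℓ) NNReal).valuationSubring →+*
          AlgebraicClosure k),
        (∀ g : absoluteGaloisGroup ℚ,
          ∃ P : Polynomial (Valued.v : Valuation (PadicAlgCl ℓ) NNReal).valuationSubring,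
            P.map (Valued.v : Valuation (PadicAlgCl ℓ) NNReal).valuationSubring.subtype =
                FramedRep.charpoly ρ g ∧
              P.map red = (FramedRep.charpoly ρbar g).map (algebraMap k (AlgebraicClosure k))) →
        -- `r̄|_{Γ_{ℚ(ζ_ℓ)}}` is irreducible (`Γ_{ℚ(ζ_ℓ)} = ker ε̄_ℓ`)
        Representation.IsIrreducible
          (((FramedRep.baseChangeRepresentation (algebraMap k (AlgebraicClosure k)) ρbar).comp
              (modPCyclotomicCharacterZMod ℚ ℓ).ker.subtype :
            Representation (AlgebraicClosure k) (modPCyclotomicCharacterZMod ℚ ℓ).ker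
              (Fin 4 → AlgebraicClosure k))) →
        -- residually automorphic from a Fontaine–Laffaille source of level prime to `ℓ`
        (∃ (π₀ : CuspidalAutomorphicRepData 4 ℚ hcpt) (ρ₀ : FramedGaloisRep ℚ (PadicAlgCl ℓ) 4),
            π₀.1.IsLAlgebraic ∧ (∃ T : InfinityType ℚ 4, π₀.1.HasInfinityType T ∧ T.IsRegular) ∧
            SatakeFrobCompatibleAE ι π₀.1 ρ₀ ∧ FramedRep.IsResiduallyCongruent ρ ρ₀ ∧
            ρ₀.IsSymplecticWithMultiplierFun (fun g => algebraMap ℚ_[ℓ] (PadicAlgCl ℓ)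
              ((((GaloisRep.cyclotomicCharacter ℚ ℓ g)⁻¹ : ℤ_[ℓ]ˣ) : ℤ_[ℓ]) : ℚ_[ℓ])) ∧
            (∀ v : HeightOneSpectrum (𝓞 ℚ), ((ℓ : ℕ) : 𝓞 ℚ) ∈ v.asIdeal → π₀.1.IsUnramifiedAt v) ∧
            ∀ (v : HeightOneSpectrum (𝓞 ℚ)) (hv : ((ℓ : ℕ) : 𝓞 ℚ) ∈ v.asIdeal),
              (PAdicHodge.fontainePstAdicCompletion v ℓ hv).IsCrystallineFramed (ρ₀.toLocal v) ∧
              ∃ a b : ℤ, b ≤ a + ((ℓ : ℤ) - 2) ∧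
                (PAdicHodge.fontainePstAdicCompletion v ℓ hv).IsDeRhamWithWeightsIn a b
                  (ρ₀.toLocal v)) →
      ∃ π : CuspidalAutomorphicRepData 4 ℚ hcpt, π.1.IsLAlgebraic ∧
        (∃ T : InfinityType ℚ 4, π.1.HasInfinityType T ∧ T.IsRegular) ∧
        SatakeFrobCompatibleAE ι π.1 ρ

/-- The conclusion of `BLGGT2014_thm421_rat_GL4` is automorphy in the sense of the tree
(`IsAutomorphicAE ι hcpt ρ`, the conclusion of lang.S03 `FontaineMazurLanglandsGLn`) together with
regularity of the infinity type of `π`. [folklore] -/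
theorem BLGGT2014_thm421_rat_GL4.isAutomorphicAE (h : BLGGT2014_thm421_rat_GL4)
    {ℓ : ℕ} [Fact ℓ.Prime] (hℓ : 11 ≤ ℓ)
    (hcpt : isCompact_glFiniteIntegralLevel 4 ℚ) (ι : PadicAlgCl ℓ ≃+* ℂ)
    (ρ : FramedGaloisRep ℚ (PadicAlgCl ℓ) 4) (hirr : ρ.toGaloisRep.IsIrreducible)
    (hunr : ∀ᶠ v : HeightOneSpectrum (𝓞 ℚ) in cofinite, ρ.IsUnramifiedAt v)
    (hsymp : ρ.IsSymplecticWithMultiplierFun (fun g => algebraMap ℚ_[ℓ] (PadicAlgCl ℓ)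
        ((((GaloisRep.cyclotomicCharacter ℚ ℓ g)⁻¹ : ℤ_[ℓ]ˣ) : ℤ_[ℓ]) : ℚ_[ℓ])))
    (hFL : ∀ (v : HeightOneSpectrum (𝓞 ℚ)) (hv : ((ℓ : ℕ) : 𝓞 ℚ) ∈ v.asIdeal),
        let D := PAdicHodge.fontainePstAdicCompletion v ℓ hv
        D.IsCrystallineFramed (ρ.toLocal v) ∧
        (letI := D.algebra
         ∀ τ : v.adicCompletion ℚ →ₐ[ℚ_[ℓ]] PadicAlgCl ℓ,
          let M := ρ.labelledHodgeTateWeightsAt v D.algebra D.𝔅 τ.toRingHom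
          M.Nodup ∧ Multiset.card M = 4 ∧ ∃ a : ℤ, ∀ h ∈ M, a ≤ h ∧ h ≤ a + ((ℓ : ℤ) - 2)))
    {k : Type} [Field k] [Fintype k] [CharP k ℓ] [TopologicalSpace k] [DiscreteTopology k]
    (ρbar : FramedGaloisRep ℚ k 4)
    (red : (Valued.v : Valuation (PadicAlgCl ℓ) NNReal).valuationSubring →+* AlgebraicClosure k)
    (hred : ∀ g : absoluteGaloisGroup ℚ,
        ∃ P : Polynomial (Valued.v : Valuation (PadicAlgCl ℓ) NNReal).valuationSubring,
          P.map (Valued.v : Valuation (PadicAlgCl ℓ) NNReal).valuationSubring.subtype =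
              FramedRep.charpoly ρ g ∧
            P.map red = (FramedRep.charpoly ρbar g).map (algebraMap k (AlgebraicClosure k)))
    (hbig : Representation.IsIrreducible
        (((FramedRep.baseChangeRepresentation (algebraMap k (AlgebraicClosure k)) ρbar).comp
            (modPCyclotomicCharacterZMod ℚ ℓ).ker.subtype :
          Representation (AlgebraicClosure k) (modPCyclotomicCharacterZMod ℚ ℓ).ker
            (Fin 4 → AlgebraicClosure k))))
    (hmod : ∃ (π₀ : CuspidalAutomorphicRepData 4 ℚ hcpt) (ρ₀ : FramedGaloisRep ℚ (PadicAlgCl ℓ) 4),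
        π₀.1.IsLAlgebraic ∧ (∃ T : InfinityType ℚ 4, π₀.1.HasInfinityType T ∧ T.IsRegular) ∧
        SatakeFrobCompatibleAE ι π₀.1 ρ₀ ∧ FramedRep.IsResiduallyCongruent ρ ρ₀ ∧
        ρ₀.IsSymplecticWithMultiplierFun (fun g => algebraMap ℚ_[ℓ] (PadicAlgCl ℓ)
          ((((GaloisRep.cyclotomicCharacter ℚ ℓ g)⁻¹ : ℤ_[ℓ]ˣ) : ℤ_[ℓ]) : ℚ_[ℓ])) ∧
        (∀ v : HeightOneSpectrum (𝓞 ℚ), ((ℓ : ℕ) : 𝓞 ℚ) ∈ v.asIdeal → π₀.1.IsUnramifiedAt v) ∧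
        ∀ (v : HeightOneSpectrum (𝓞 ℚ)) (hv : ((ℓ : ℕ) : 𝓞 ℚ) ∈ v.asIdeal),
          (PAdicHodge.fontainePstAdicCompletion v ℓ hv).IsCrystallineFramed (ρ₀.toLocal v) ∧
          ∃ a b : ℤ, b ≤ a + ((ℓ : ℤ) - 2) ∧
            (PAdicHodge.fontainePstAdicCompletion v ℓ hv).IsDeRhamWithWeightsIn a b (ρ₀.toLocal v)) :
    IsAutomorphicAE ι hcpt ρ ∧
      ∃ π : CuspidalAutomorphicRepData 4 ℚ hcpt, π.1.IsLAlgebraic ∧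
        (∃ T : InfinityType ℚ 4, π.1.HasInfinityType T ∧ T.IsRegular) ∧
        SatakeFrobCompatibleAE ι π.1 ρ := by
  obtain ⟨π, hL, hreg, hsat⟩ :=
    h ℓ hℓ hcpt ι ρ hirr hunr hsymp hFL k ρbar red hred hbig hmod
  exact ⟨⟨π, hL, hsat⟩, π, hL, hreg, hsat⟩

end Literature.NumberTheory.Automorphic

end
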